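import Mathlib

/-!
# Parity / mod-8 lemmas used in the square-class bookkeeping (T1 §5, Options 2 and 3)

Blind cell `pub-manin-gamma0`, seat p3; paper references `proofs/T1_lead.md` Prop. 5.1 and `review/ALGEBRA_p3.md`.
* `even_of_sq_add_mul_sq_eq_two_mul_sq` : `a, b` odd, `p ≡ 7 (mod 8)`, `a² + p b² = 2 m²` ⟹ `m` even  (Option 2: «m even»).
* `not_isSquare_sq_sub_mul_sq`           : `γ, δ` odd, `p ≡ 7 (mod 8)` ⟹ `γ² - p δ²` is not a square        (Option 3, order-4 case).
* `not_sq_add_sq_of_odd`                 : `γ, δ` odd ⟹ `γ² + δ²` is not a square                          (Option 3, order-8 case).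
Only Mathlib is imported.
-/

namespace ManinGamma
namespace Parity

/-- The square of an odd integer is `1` modulo `8`. -/
theorem sq_cast_zmod_eight_of_odd {a : ℤ} (ha : Odd a) : ((a : ZMod 8)) ^ 2 = 1 := by
  obtain ⟨k, rfl⟩ := ha
  push_cast
  generalize (k : ZMod 8) = x
  revert x
  decide

/-- **Option 2 parity.** If `a, b` are odd, `p ≡ 7 (mod 8)` and `a² + p b² = 2 m²`, then `m` is even. -/
theorem even_of_sq_add_mul_sq_eq_two_mul_sq {a b m p : ℤ} (ha : Odd a) (hb : Odd b) (hp : p % 8 = 7)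
    (h : a ^ 2 + p * b ^ 2 = 2 * m ^ 2) : Even m := by
  have hp' : (p : ZMod 8) = 7 := by
    have h1 : ((p % 8 : ℤ) : ZMod 8) = (p : ZMod 8) := by exact_mod_cast ZMod.intCast_mod p 8
    rw [hp] at h1
    exact_mod_cast h1.symm
  have h8 : (a : ZMod 8) ^ 2 + (p : ZMod 8) * (b : ZMod 8) ^ 2 = 2 * (m : ZMod 8) ^ 2 := by exact_mod_cast congrArg (Int.cast : ℤ → ZMod 8) h
  rw [sq_cast_zmod_eight_of_odd ha, sq_cast_zmod_eight_of_odd hb, hp'] at h8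
  -- now 1 + 7 = 2 m² in ZMod 8, i.e. 2 m² = 0
  rcases Int.even_or_odd m with hm | hm
  · exact hm
  · exfalso
    rw [sq_cast_zmod_eight_of_odd hm] at h8
    revert h8; decide

/-- **Option 3 (order-4 case).** If `γ, δ` are odd and `p ≡ 7 (mod 8)` then `γ² - p δ²` is not a perfect square
(it is `≡ 2 (mod 8)`). -/
theorem not_isSquare_sq_sub_mul_sq {γ δ p : ℤ} (hγ : Odd γ) (hδ : Odd δ) (hp : p % 8 = 7) :
    ¬ IsSquare (γ ^ 2 - p * δ ^ 2) := by
  rintro ⟨r, hr⟩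
  have hp' : (p : ZMod 8) = 7 := by
    have h1 : ((p % 8 : ℤ) : ZMod 8) = (p : ZMod 8) := by exact_mod_cast ZMod.intCast_mod p 8
    rw [hp] at h1
    exact_mod_cast h1.symm
  have h8 : (γ : ZMod 8) ^ 2 - (p : ZMod 8) * (δ : ZMod 8) ^ 2 = (r : ZMod 8) * (r : ZMod 8) := by
    exact_mod_cast congrArg (Int.cast : ℤ → ZMod 8) hr
  rw [sq_cast_zmod_eight_of_odd hγ, sq_cast_zmod_eight_of_odd hδ, hp'] at h8
  generalize (r : ZMod 8) = x at h8
  revert x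
  decide

/-- **Option 3 (order-8 case).** The sum of two odd squares is not a square (it is `≡ 2 (mod 4)`). -/
theorem not_sq_add_sq_of_odd {γ δ : ℤ} (hγ : Odd γ) (hδ : Odd δ) : ¬ IsSquare (γ ^ 2 + δ ^ 2) := by
  rintro ⟨r, hr⟩
  have h8 : (γ : ZMod 8) ^ 2 + (δ : ZMod 8) ^ 2 = (r : ZMod 8) * (r : ZMod 8) := by
    exact_mod_cast congrArg (Int.cast : ℤ → ZMod 8) hr
  rw [sq_cast_zmod_eight_of_odd hγ, sq_cast_zmod_eight_of_odd hδ] at h8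
  generalize (r : ZMod 8) = x at h8
  revert x
  decide

end Parity
end ManinGamma
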